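/-
Copyright: statement-level skeleton of a published paper (lit-balaban cell, Phase-2 proof seat p18 gen 8). No proof claims
beyond what the kernel checks below.
-/
import Mathlib
import Literature.MathematicalPhysics.QuantumFieldTheory.Balaban1983to89.B3Eq320PositiveSubgraphs
import Literature.MathematicalPhysics.QuantumFieldTheory.Balaban1983to89.B3Sect3Graphs318

/-!
# B3 — T. Bałaban, *(Higgs)₂,₃ quantum fields in a finite volume. III. Renormalization*, CMP **88** (1983) 411–445
[Balaban1983Higgs3], p. 438 [PDF 28], **the generalized graph (3.20) of a primitively divergent graph (3.18)** — WORKED for the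
seventh picture of (3.18) (two vertices (1.6) joined by three scalar lines, the «sunset»; `B3Sect3Graphs318.g318g`): the graph as a
count datum of p19's calculus, its blocks along ALL SIX orderings, their degrees (2.2) (`2`, `1` for the proper subgraphs, `0` for
the whole graph — *"All the remaining divergent graphs of this type have degrees equal to 0"*), and the generalized graph (3.20)
(one line dimension raised by `α`) as a member of the family of Proposition 2.2 (gen 7's `famK`) meeting its PRINTED hypothesis
*"whose every subgraph has a positive degree"* — an instance of gen 8's abstract (3.20) theorem
`B3Eq320PositiveSubgraphs.posSubgraphsExcept24_of_degZero`

statement-level skeleton of published theorems with citation tags; proofs where landed; nothing here is a claim about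
the Yang–Mills mass gap

PDF held: `paper:balaban1983-higgs-2-3-quantum-fields-finite-volume` (journal page = PDF page + 410); p. 438 [PDF 28] read as
image (`…/b2b-balaban-ref1/pages/1983-cmp88-higgs23-III/1983-cmp88-higgs23-III-p028-x2.png`: pictures (3.18), (3.20)).

CITATION HEADER (lean-in-tree rule).  Part of the lit-balaban TYPED SKELETON (HOME `run/shared/lean/pub/lit-balaban/`), PHASE 2,
seat p18 generation 8.  WHAT IS REPRODUCED: rows **B3.Eq3.18-3.20** ((3.18) seventh picture ↦ its generalized graph (3.20); cell:
*"the picture (3.20) not typed"*) and **B3.Prop2.2** (a three-line worked member of the family, all orderings) of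
`HOME/lit-balaban-r15/ROWS-B3.md` (fold owner r15, referee ref-4).  CONSUMES BY NAME, nothing re-proved: p19's `Counts`/`Model`
calculus and `degQ` (`B3Ineq215Instance`, `B3Ineq215Quotient`, `B3Prop21Instance`, `B3Prop21Model`), gen 7's `B3FreeLine` (`CGraphK`,
`DatumK`, `expansionK`, `famK`, `Is24K`, `prop21_freeLines`), gen 8's `B3Eq322Member.paramsK322` (constants `d = 3`, `L = 2`, `δ₁ = 1`,
menu `{0, ½}`) and `B3Eq320PositiveSubgraphs` (`posSubgraphsExcept24_of_degZero`, `posSubgraphs_of_properPos`), p18 g3's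
`B3Sect3Graphs318.g318g_deg` (the same graph in the vertex-catalogue model: consistency of the two degree counts).

THE PRINTED TEXT (verbatim, p. 438).  *"Let us consider the other cases of self-energy graphs for scalar fields. All the remaining
divergent graphs of this type have degrees equal to 0. Primitively divergent graphs, i.e. the graphs (3.18) [seven pictures; the
seventh: two vertices (1.6) joined by three φ′-lines] are treated in a simpler way. If Σ(x,x′) is an expression corresponding to any
such graph, then we have a graph with mass renormalization counterterm of the form −Σ_{x′}η^dΣ(x,x′), and we write [(3.19)]. We get
a generalized expression of degree +α represented by some generalized graph whose every subgraph has a positive degree also.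
Graphically we write it as follows [(3.20): Σ − counterterm = Σ with `+α` inside and `−α` on the outgoing leg]."*

WHAT IS PROVED.  §1 the count datum `graph320` (`Counts (Fin 2) 3`: three scalar lines `x → x′`, no differentiation, η-powers `0`,
`d = 3`) is invariant under relabelling (`relabelCounts_graph320`, `rfl`: the three lines are alike), so ONE computation serves all
six orderings: from level `1` on both vertices form one block represented by `x = 0` (`rep_eq_zero`, `fiber_eq_univ`), the block
`G_i` consists of the first `i` lines (`before_eq`), every line has dimension `a = −(d−2) = −1` (`lineDimQ_graph320`), and (2.2)
gives **`degQ_one = 2`, `degQ_two = 1`, `degQ_of_three_le = 0`** (`= B3Sect3Graphs318.g318g_deg` at `d = 3`: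
`degQ_whole_eq_g318g_deg`).  §2 the generalized graph (3.20): `κ320` = `+½` on the line `0` (`α = ½`, the weight `|x−x′|^α` of
(3.19) put on one of the three coincident-endpoint lines), `memberK320 : CGraphK (paramsK322 Cmax CD) mb` (`3 ≤ mb`); its proper
non-trivial blocks have positive degree (`properPos_graph320`), its whole blocks degree `0` (`degZero_graph320`); hence
**`posSubgraphsExcept24_memberK320`** (r15's PRINTED hypothesis, by `posSubgraphsExcept24_of_degZero`), the exception-free form
`posSubgraphs_memberK320`, `not_is24_memberK320` (no (2.4)-block: no differentiated line) and **`ineq133_memberK320`** ((1.33) by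
`prop21_freeLines`).
HONEST SCOPE: as `B3Eq322Member` — a statement about the abstract-amplitude family `famK`; `α = ½` a sample value in the finite
menu; which of the three lines carries `+α` is immaterial for the degrees (all three join `x` and `x′`); the other six pictures of
(3.18) contain vector lines and (1.8)/(1.10) vertices and are not typed here.  D-0026: definitions with bodies and theorems only
(no named facts, no `sorry`); standard axioms.  Unit `lit-balaban-p18-g8` (literature-prover-lit-balaban-p18-g8-0), HOME
`run/shared/lean/pub/lit-balaban/`, 2026-08-21.
-/

open Finset

namespace Literature.MathematicalPhysics.QuantumFieldTheory.Balaban1983to89.B3Eq320SunsetMember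

open B3Ineq215 B3Ineq213 B3Sect2FirstEstimate B3Prop1 B3FreeLine B3Eq322Member B3Eq320PositiveSubgraphs

/-! ## §1 The seventh graph of (3.18) as a count datum; blocks and degrees along all orderings -/

/-- **The seventh picture of (3.18)** p. 438 (the «sunset») as a count datum (`d = 3`, `L = 2`, `δ₁ = 1`): vertices `0` (= `x`)
and `1` (= `x′`), three scalar lines `x → x′`, no differentiations, no averaged vector legs, η-powers `0` (vertices (1.6)).
[cite: Balaban1983Higgs3, (3.18) p.438] -/
noncomputable def graph320 : Counts (Fin 2) 3 where
  src := fun _ => 0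
  tgt := fun _ => 1
  touches := fun v => ⟨0, by fin_cases v <;> simp⟩
  diffOn := fun _ _ => 0
  vecLegAvg := fun _ _ => 0
  etaPow := fun _ => 0
  d := 3
  L := 2
  δ₁ := 1
  d_pos := by norm_num
  two_le_L := le_rfl
  δ₁_pos := one_pos

/-- The three lines are alike: relabelling along any ordering `σ` gives the same count datum, so the blocks and degrees below
serve all `3! = 6` orderings. [cite: Balaban1983Higgs3, (2.7) p.425] -/
theorem relabelCounts_graph320 (σ : Equiv.Perm (Fin 3)) : relabelCounts graph320 σ = graph320 := rfl

/-- The graph is connected: each line joins its two vertices. [cite: Balaban1983Higgs3, (3.18) p.438] -/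
theorem linesConnect_graph320 : LinesConnect graph320.src graph320.tgt := by
  have h01 : Relation.EqvGen (fun a b : Fin 2 => ∃ l, graph320.src l = a ∧ graph320.tgt l = b) 0 1 :=
    Relation.EqvGen.rel _ _ ⟨0, rfl, rfl⟩
  intro u w
  fin_cases u <;> fin_cases w
  · exact Relation.EqvGen.refl _
  · exact h01
  · exact h01.symm
  · exact Relation.EqvGen.refl _

/-- After the first line the two vertices form ONE block represented by `x = 0`, and the later lines (same endpoints) do not
change it: the representative map is constant `0` from level `1` on. [cite: Balaban1983Higgs3, (2.16) p.428] -/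
theorem rep_eq_zero {n : ℕ} (hn : 1 ≤ n) (v : Fin 2) : graph320.toModel.rep n v = 0 := by
  induction n generalizing v with
  | zero => omega
  | succ n ih =>
    by_cases hn0 : n = 0
    · subst hn0
      rw [graph320.toModel.rep_succ (by norm_num) v]
      unfold Model.rho Model.bs Model.bt
      simp only [Model.rep_zero]
      fin_cases v <;> simp [graph320, Counts.toModel]
    · by_cases hn3 : n < 3
      · rw [graph320.toModel.rep_succ hn3 v]
        unfold Model.rho Model.bs Model.bt
        simp only [ih (by omega)]
        split_ifs <;> rfl
      · rw [graph320.toModel.rep_succ_of_not_lt hn3 v]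
        exact ih (by omega) v

/-- The block at every level `i ≥ 1` is the whole vertex set. [cite: Balaban1983Higgs3, (2.16) p.428] -/
theorem fiber_eq_univ {i : ℕ} (hi : 1 ≤ i) : graph320.toModel.fiber i 0 = univ := by
  ext v; simp [Model.mem_fiber, rep_eq_zero hi]

/-- The line set of `G_i` (`i ≥ 1`) is the first `i` lines of the ordering. [cite: Balaban1983Higgs3, (2.16) p.428] -/
theorem before_eq {i : ℕ} (hi : 1 ≤ i) : graph320.toModel.before i 0 = univ.filter fun l : Fin 3 => (l : ℕ) < i := by
  ext l
  simp only [Model.mem_before, rep_eq_zero hi, and_true, mem_filter, mem_univ, true_and]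

/-- A representative of a non-trivial block is the vertex `0`, at a level `i ≥ 1`. [cite: Balaban1983Higgs3, Prop. 2.1 p.424] -/
theorem block_graph320 {i : ℕ} {b : Fin 2} (hb : b ∈ graph320.toModel.reps i) (hn : graph320.toModel.Nontriv i b) :
    1 ≤ i ∧ b = 0 := by
  have hi : 1 ≤ i := by
    by_contra h0
    have h0' : i = 0 := by omega
    rw [h0'] at hn
    exact absurd hn (by simp [Model.Nontriv, Model.before_zero])
  refine ⟨hi, ?_⟩
  have := graph320.toModel.mem_reps.1 hb
  rw [rep_eq_zero hi] at this
  exact this.symm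

/-- **The line dimensions (2.14)**: `a = −(d−2) = −1` for each of the three scalar lines (two legs of dimension `−½`, no
differentiation). [cite: Balaban1983Higgs3, (2.14) p.427] -/
theorem lineDimQ_graph320 (l : Fin 3) : lineDimQ graph320 l = -1 := by
  unfold lineDimQ legExpQ Counts.legsOn
  simp only [graph320, Fin.sum_univ_two]
  norm_num

/-- **(2.2) at level `i ≥ 1`**: `D(G_i) = (3+0) + (3+0) − 3 − #{lines among the first i} = 3 − min(i,3)`; spelled out below.
[cite: Balaban1983Higgs3, (2.2) p.423] -/
theorem degQ_eq {i : ℕ} (hi : 1 ≤ i) :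
    degQ graph320 i 0 = 3 - ((univ.filter fun l : Fin 3 => (l : ℕ) < i).card : ℚ) := by
  unfold degQ
  rw [fiber_eq_univ hi, before_eq hi]
  simp only [lineDimQ_graph320, sum_const]
  simp only [graph320, Fin.sum_univ_two, Nat.cast_ofNat, Nat.cast_zero, add_zero]
  ring

/-- `D(G₁) = 2` (one line, both vertices). [cite: Balaban1983Higgs3, (2.2) p.423] -/
theorem degQ_one : degQ graph320 1 0 = 2 := by
  rw [degQ_eq le_rfl]
  have : (univ.filter fun l : Fin 3 => (l : ℕ) < 1) = {0} := by decide
  rw [this, card_singleton]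
  norm_num

/-- `D(G₂) = 1` (two lines, both vertices). [cite: Balaban1983Higgs3, (2.2) p.423] -/
theorem degQ_two : degQ graph320 2 0 = 1 := by
  rw [degQ_eq one_le_two]
  have : (univ.filter fun l : Fin 3 => (l : ℕ) < 2).card = 2 := by decide
  rw [this]
  norm_num

/-- **p. 438 "All the remaining divergent graphs of this type have degrees equal to 0"**: `D(G) = D(G₃) = 0` for the whole
graph (all three lines), at every level `i ≥ 3`. [cite: Balaban1983Higgs3, (3.18) p.438] -/
theorem degQ_of_three_le {i : ℕ} (hi : 3 ≤ i) : degQ graph320 i 0 = 0 := by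
  rw [degQ_eq (by omega)]
  have : (univ.filter fun l : Fin 3 => (l : ℕ) < i) = univ := by
    ext l
    simp only [mem_filter, mem_univ, true_and, iff_true]
    exact lt_of_lt_of_le l.isLt hi
  rw [this, card_univ, Fintype.card_fin]
  norm_num

/-- Consistency of the two degree counts of the tree for this graph: p19's (2.2) on the count datum and p18 g3's vertex-catalogue
degree `B3Sect3Graphs318.g318g_deg` (`D = 6 − 2d`) agree at `d = 3`. [cite: Balaban1983Higgs3, (3.18) p.438] -/
theorem degQ_whole_eq_g318g_deg (nbar : ℕ) : degQ graph320 3 0 = (B3Sect3Graphs318.g318g nbar).deg 3 := by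
  rw [degQ_of_three_le le_rfl, B3Sect3Graphs318.g318g_deg]
  norm_num

/-- **Primitive divergence** (*"graphs whose every proper subgraph is convergent"*, p. 435): along every ordering, a non-trivial
block NOT containing all the lines has positive degree (`2` or `1`). [cite: Balaban1983Higgs3, (3.18) p.438] -/
theorem properPos_graph320 (σ : Equiv.Perm (Fin 3)) (i : ℕ) (b : Fin 2) (hb : b ∈ (relabelCounts graph320 σ).toModel.reps i)
    (hn : (relabelCounts graph320 σ).toModel.Nontriv i b) (hne : (relabelCounts graph320 σ).toModel.before i b ≠ univ) :
    0 < degQ (relabelCounts graph320 σ) i b := by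
  rw [relabelCounts_graph320] at hb hn hne ⊢
  obtain ⟨hi, rfl⟩ := block_graph320 hb hn
  have hi3 : i < 3 := by
    by_contra h3
    apply hne
    rw [before_eq hi]
    ext l
    simp only [mem_filter, mem_univ, true_and, iff_true]
    exact lt_of_lt_of_le l.isLt (by omega)
  have hi' : i = 1 ∨ i = 2 := by omega
  rcases hi' with rfl | rfl
  · rw [degQ_one]; norm_num
  · rw [degQ_two]; norm_num

/-- … while a block containing ALL the lines (the whole graph, from level `3` on) has degree `0`. [cite: Balaban1983Higgs3, (3.18) p.438] -/
theorem degZero_graph320 (σ : Equiv.Perm (Fin 3)) (i : ℕ) (b : Fin 2)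
    (hw : (relabelCounts graph320 σ).toModel.before i b = univ) : degQ (relabelCounts graph320 σ) i b = 0 := by
  rw [relabelCounts_graph320] at hw ⊢
  have hmem : (2 : Fin 3) ∈ graph320.toModel.before i b := by rw [hw]; exact mem_univ _
  rw [Model.mem_before] at hmem
  have hi3 : 3 ≤ i := by have := hmem.1; simp at this; omega
  have hb0 : b = 0 := by
    have := hmem.2
    rw [rep_eq_zero (by omega)] at this
    exact this.symm
  subst hb0
  exact degQ_of_three_le hi3

/-! ## §2 The generalized graph (3.20) as a member of the family of Proposition 2.2 -/

/-- **The extra line dimensions of the generalized graph (3.20)**: `+α` (`α = ½`) on one of the three lines — the weight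
`|x−x′|^α` of the right side of (3.19) — the other two keep their standard dimension. [cite: Balaban1983Higgs3, (3.20) p.438] -/
def κ320 : Fin 3 → ℚ := fun l => if l = 0 then 1 / 2 else 0

/-- The exponents are taken from the menu `{0, ½}` of `paramsK322`. [cite: Balaban1983Higgs3, Prop. 2.2 p.428] -/
theorem κ320_mem_menu (Cmax CD : ℝ) (l : Fin 3) : κ320 l ∈ (paramsK322 Cmax CD).menu := by
  unfold κ320 paramsK322
  split_ifs <;> simp

/-- The exponents are non-negative. [cite: Balaban1983Higgs3, (3.20) p.438] -/
theorem κ320_nonneg (l : Fin 3) : 0 ≤ κ320 l := by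
  unfold κ320; split_ifs <;> norm_num

/-- *"a generalized expression of degree +α"*: the extra dimensions add up to `α = ½`. [cite: Balaban1983Higgs3, (3.20) p.438] -/
theorem sum_κ320 : ∑ l, κ320 l = 1 / 2 := by
  simp [κ320]

/-- **The generalized graph (3.20) of the seventh graph of (3.18) is a member of the family of Proposition 2.2** (`famK`, gen 7;
constants `paramsK322`) at every size bound `mb ≥ 3`. [cite: Balaban1983Higgs3, Prop. 2.2 p.428] -/
noncomputable def memberK320 (Cmax CD : ℝ) {mb : ℕ} (h : 3 ≤ mb) : CGraphK (paramsK322 Cmax CD) mb where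
  n := 2
  m := 3
  m_le := h
  G := graph320
  d_eq := rfl
  L_eq := rfl
  δ₁_eq := rfl
  conn := linesConnect_graph320
  κ := κ320
  κ_mem := κ320_mem_menu Cmax CD

/-- **(3.20): "some generalized graph whose every subgraph has a positive degree also" — the PRINTED hypothesis of Propositions
2.1/2.2 holds for the generalized graph, for all six orderings, through positivity**: proper subgraphs of degrees `2`, `1`, the
whole graph of generalized degree `0 + α = ½`; an instance of `posSubgraphsExcept24_of_degZero`. [cite: Balaban1983Higgs3, (3.20) p.438] -/
theorem posSubgraphsExcept24_memberK320 (Cmax CD : ℝ) {mb : ℕ} (h : 3 ≤ mb) (D : DatumK (paramsK322 Cmax CD)) :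
    PosSubgraphsExcept24 (expansionK (paramsK322 Cmax CD) mb D) (memberK320 Cmax CD h) :=
  posSubgraphsExcept24_of_degZero D _ κ320_nonneg (by change (0 : ℚ) < ∑ l, κ320 l; rw [sum_κ320]; norm_num)
    (fun σ i b hb hn hne => properPos_graph320 σ i b hb hn hne) (fun σ i b hw => degZero_graph320 σ i b hw)

/-- The exception-free form: EVERY connected subgraph along every ordering has positive generalized degree.
[cite: Balaban1983Higgs3, (3.20) p.438] -/
theorem posSubgraphs_memberK320 (Cmax CD : ℝ) {mb : ℕ} (h : 3 ≤ mb) (D : DatumK (paramsK322 Cmax CD)) :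
    ∀ H : (expansionK (paramsK322 Cmax CD) mb D).Sub (memberK320 Cmax CD h),
      0 < (expansionK (paramsK322 Cmax CD) mb D).subDeg (memberK320 Cmax CD h) H :=
  posSubgraphs_of_properPos D _ κ320_nonneg (fun σ i b hb hn hne => properPos_graph320 σ i b hb hn hne)
    (fun σ i b hw => by
      have h0 := degZero_graph320 σ i b hw
      change 0 < degQ (relabelCounts graph320 σ) i b + ∑ l, κ320 l
      rw [h0, sum_κ320]; norm_num)

/-- No block of the member is a (2.4)-block: no line of the graph carries a differentiation. [cite: Balaban1983Higgs3, (2.4) p.424] -/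
theorem not_is24_memberK320 (Cmax CD : ℝ) {mb : ℕ} (h : 3 ≤ mb) (D : DatumK (paramsK322 Cmax CD)) :
    ∀ H : (expansionK (paramsK322 Cmax CD) mb D).Sub (memberK320 Cmax CD h),
      ¬ (expansionK (paramsK322 Cmax CD) mb D).Is24 (memberK320 Cmax CD h) H := by
  show ∀ H : Component graph320, ¬ Is24K (relabelCounts graph320 H.1) (κ320 ∘ H.1) H.2.1 H.2.2.1
  rintro ⟨σ, i, b, hb, hn⟩
  rintro ⟨⟨-, l, -, hdiff, -⟩, -⟩
  change 1 ≤ (0 : ℕ) at hdiff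
  exact absurd hdiff (by norm_num)

/-- **(1.33) for the generalized graph (3.20)**, as asserted by gen 7's `prop21_freeLines` (the constant `O(1)(n̄)` of the family at
the size bound `m̄(n̄) ≥ 3`): Proposition 2.2 APPLIES to the right side of (3.20). [cite: Balaban1983Higgs3, Prop. 2.2 p.428] -/
theorem ineq133_memberK320 (Cmax CD : ℝ) (mbar : ℕ → ℕ) (nbar : ℕ) (h : 3 ≤ mbar nbar) (α₀ : ℝ) (h0 : 0 < α₀)
    (h1 : α₀ < 1) :
    ∃ δ₀ C : ℝ, 0 < δ₀ ∧ 0 < C ∧ ∀ D : DatumK (paramsK322 Cmax CD),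
      Ineq133At (famK (paramsK322 Cmax CD) mbar nbar D).toExpansion
        ((famK (paramsK322 Cmax CD) mbar nbar D).single (memberK320 Cmax CD h)) α₀ δ₀ C := by
  obtain ⟨δ₀, hδ₀, H⟩ := prop21_freeLines (paramsK322 Cmax CD) mbar
  obtain ⟨C, hC, HC⟩ := H α₀ h0 h1 nbar
  exact ⟨δ₀, C, hδ₀, hC, fun D => HC D _ (posSubgraphsExcept24_memberK320 Cmax CD h D)⟩

end Literature.MathematicalPhysics.QuantumFieldTheory.Balaban1983to89.B3Eq320SunsetMember
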